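import Literature.AlgebraicGeometry.Resolution.PointBlowupShade
import Mathlib.Algebra.Order.Ring.Rat

/-!
# Weighted (stack-theoretic / cobordant) blow-ups of `x^q + F(u)`: coordinate centres, the cobordant
  transform, and the "drops / stalls / increases" predicates of the transplanted invariant

Statement-level typing — definitions with bodies and one proved order-theoretic remark; NO published
theorem is asserted here as a fact — of the objects the resolution observatory (`pub-rosobs`,
carver-g3) uses to run the characteristic-zero weighted-blow-up algorithm of Abramovich–Temkin–
Włodarczyk [AbramovichTemkinWlodarczyk2024] and its characteristic-`p` plane-curve version by
Abramovich–Quek–Schober [AbramovichQuekSchober2024, AbramovichQuekSchober2025] VERBATIM on purely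
inseparable hypersurfaces `x^q + F(u_1, …, u_m)`, `q = p^e`, of any dimension:

1. COORDINATE CENTRES. A centre `J = (x_1^{a_1}, …, x_k^{a_k})` "corresponds to a unique monomial
   valuation associated to the cocharacter `(a_1^{-1}, …, a_k^{-1}, 0, …, 0)`, where
   `v(∏ x_i^{c_i}) = Σ c_i/a_i`" and "`J` is admissible for `I` if and only if `v_J(f) ≥ 1` for all
   `f ∈ I`" [AbramovichTemkinWlodarczyk2024, §2.4 and §5.1]; [AbramovichQuekSchober2025, Def. 3.3].
   Here the first generator is pinned to `x^q` (`γ_x = 1/q`) and `WeightedBlowup.IsAdmissibleFor γ F`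
   is the condition on the monomials of the residual polynomial `F` (`γ : σ → ℚ` the cocharacter on
   the `u`-variables, `γ_i = 0` for variables outside the centre).
2. THE TRANSPLANTED INVARIANT (observatory convention FW2, derived here — it is NOT a published
   definition in this generality). ATW prove in characteristic `0` that `inv_p(I)` "is the maximal
   invariant of a center admissible for `I`" [AbramovichTemkinWlodarczyk2024, Thm. 14], the maximum
   being over ALL regular systems of parameters; AQS prove the same lex-max characterisation for
   plane curves in characteristic `p` with the invariant `(ν, νδ)` read off Hironaka's characteristic
   polyhedron [AbramovichQuekSchober2024, Thm. 4.2]; [AbramovichQuekSchober2025, Def. 3.2, Thm. 3.5].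
   `WeightedBlowup.IsInvCoord q F v` says: `v = (q, c_1 ≤ … ≤ c_k)` is the maximum, in ATW's order
   `ATW.TruncLex.lt` ("truncated sequences larger", §5.1), of the invariants of the admissible centres
   that are MONOMIAL IN THE GIVEN COORDINATES `(x, u)` (the residual `F` being kept cleaned of `q`-th
   power monomials, the only coordinate freedom the observatory exercises on `x`). Its second entry is
   `ord₀ F_clean = ν·δ(Δ(f;u))` with `δ(Δ) = inf{v_1 + … + v_e}` [AbramovichQuekSchober2025, §2].
3. THE BLOW-UP ON THE COBORDANT MODEL. For the reduced centre `J̄ = (x^{1/w_0}, u_i^{1/w_i})`,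
   `ℓ·(1/w_0, 1/w_i) = (q, c_i)` [AbramovichQuekSchober2025, Def. 4.1], the extended Rees algebra has
   the presentation `O[s, x', u'_i]/(x − s^{w_0}x', u_i − s^{w_i}u'_i)`, `B = Spec R̃` is the
   degeneration to the weighted normal cone, `B_+ = B ∖ V(x', u'_S)`, `Bl_{J̄} = [B_+/𝔾_m]`, and the
   proper transform is `f'(s, x', u') = s^{−ℓ} f(s^{w_0}x', s^{w_i}u'_i)` [AbramovichQuekSchober2025,
   Constr. 4.2, Def. 4.3, Def. 4.5]; this `B` is Włodarczyk's full cobordant blow-up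
   `Spec O_X[t^{-1}, t^{w_1}x_1, …, t^{w_k}x_k]` with `s = t^{-1}` [Wlodarczyk2022, Def. 2.3.5].
   `WeightedBlowup.cobordantTransform` is `F ↦ s^{−ℓ}F(s^{w}u')` on `MvPolynomial (Option σ) K`
   (the exceptional variable `s` is `none`); a point of the exceptional divisor `{s = 0}` over the
   origin is `(x' = x₀, u' = b)`, and the observatory evaluates orders and invariants ON `B_+`
   (never on the flat `μ`-slices `u'_i = 1`: "Étale slices are good, flat slices are not"
   [AbramovichQuekSchober2024, Rem. 5.7, Ex. 5.8]); `WeightedBlowup.HasEtaleSlice` records when an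
   étale slice exists (some non-vanishing coordinate of weight prime to `p`; stabilisers are the
   `μ_{w_i}` [AbramovichQuekSchober2025, Lemma 4.4]; charts [AbramovichTemkinWlodarczyk2024, §3.4]).
4. EVENTS: `IsEquimultiplePoint` (order again `q`), `OrderDrops` (AQS prove the order drops at every
   point over `q` for plane curves [AbramovichQuekSchober2024, Thm. 1.1 (3)]; ATW prove `inv` drops in
   characteristic `0` [AbramovichTemkinWlodarczyk2024, Thm. 18]), and for the transplanted invariant
   `SecondEntryDrops/Stalls/Increases` (the pair `(q, ord₀ F_clean)`) and
   `InvCoordDrops/Stalls/Increases`.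
5. A REMARK (proved, derived here): on the cobordant models the number of variables grows by one per
   blow-up and ATW's order is not well-founded on sequences of unbounded length
   (`ATW.TruncLex.exists_descending_chain`: `(2,5,5) > (2,5,5,5) > …`), so a `TruncLex`-decrease of the
   coordinate invariant on `B_+` is not by itself a termination measure; ATW's value set `Γ_n` is
   well-ordered for fixed `n` [AbramovichTemkinWlodarczyk2024, §5.1].

The kernel-checked rows (Whitney umbrella loop, Hauser's surface, AQS's examples) are in
`KangarooAtlasCertWeighted`. Junk-value conventions: natural-number subtraction in
`cobordantExponent` is meaningful under admissibility (`Σ w_i d_i ≥ ℓ` on the support of `F`).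
-/

open MvPolynomial Finset

open scoped BigOperators

noncomputable section

namespace Literature.AlgebraicGeometry.Resolution

open Literature.AlgebraicGeometry.Resolution.Hauser2010

/-! ## 1. Coordinate centres and the transplanted invariant -/

namespace WeightedBlowup

variable {σ : Type*} {K : Type*} [CommRing K]

/-- The **monomial valuation** of the centre with cocharacter `γ` (`γ_i = 1/c_i` on the centre
variables, `0` elsewhere): `v_J(u^d) = Σ_i d_i·γ_i`.
[cite: AbramovichTemkinWlodarczyk2024, §2.4 (monomial valuation of a center)] -/
def monomialValuation (γ : σ → ℚ) (d : σ →₀ ℕ) : ℚ :=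
  d.sum fun i n => (n : ℚ) * γ i

/-- **Admissibility** of the coordinate centre `(x^q, u_i^{1/γ_i})` for `x^q + F`: `v_J ≥ 1` on every
monomial of `F` (the generator `x^q` has valuation `1` by the normalisation `γ_x = 1/q`).
"`J` is admissible for `I` if and only if `v_J(f) ≥ 1` … `Σ α_i/a_i ≥ 1` whenever `c_α ≠ 0`."
[cite: AbramovichTemkinWlodarczyk2024, §5.1 (admissibility via the monomial valuation)] -/
def IsAdmissibleFor (γ : σ → ℚ) (F : MvPolynomial σ K) : Prop :=
  ∀ d ∈ F.support, 1 ≤ monomialValuation γ d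

/-- The **invariant of a coordinate centre**: `(q, c_1 ≤ … ≤ c_k)`, the exponents `c_i = 1/γ_i` of the
centre variables listed increasingly after the pinned first entry `q` (ATW: `a_1 ≤ a_2 ≤ …`; AQS:
"we restrict attention to centers with `a_1 ≤ a_2`").
[cite: AbramovichQuekSchober2025, Thm. 3.5 (lex-max over admissible centers)] -/
def centreInvariant [Fintype σ] (q : ℕ) (γ : σ → ℚ) : ATW.Invariant :=
  (q : ℚ) :: (((Finset.univ.filter fun i => γ i ≠ 0).toList.map fun i => (γ i)⁻¹).insertionSort
    (· ≤ ·))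

/-- **Transplanted invariant (observatory convention FW2, derived here).** `IsInvCoord q F v`: `v` is
the maximum, for ATW's order (truncations larger), of the invariants of the non-negative cocharacters
`γ` admissible for `F` — i.e. of the admissible centres MONOMIAL IN THE GIVEN COORDINATES. In
characteristic `0` and maximising over all coordinates this maximum is `inv_p`
(ATW Thm. 14); for plane curves in characteristic `p` it is `(ν, νδ)` (AQS 2024 Thm. 4.2).
[cite: AbramovichTemkinWlodarczyk2024, Thm. 14 (inv = maximal invariant of an admissible center)] -/
def IsInvCoord [Fintype σ] (q : ℕ) (F : MvPolynomial σ K) (v : ATW.Invariant) : Prop :=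
  (∃ γ : σ → ℚ, (∀ i, 0 ≤ γ i) ∧ IsAdmissibleFor γ F ∧ centreInvariant q γ = v) ∧
    ∀ γ : σ → ℚ, (∀ i, 0 ≤ γ i) → IsAdmissibleFor γ F → ¬ ATW.TruncLex.lt v (centreInvariant q γ)

/-! ## 2. Reduced weights and the cobordant transform -/

/-- **Reduced weights** of the centre with cocharacter `γ` and first entry `q`: positive integers
`w₀` (for `x`) and `w_i` (for the centre variables, `0` outside), and `ℓ`, with
`ℓ·(1/w₀, 1/w_i) = (q, c_i)` — i.e. `ℓ = q·w₀`, `w_i = ℓ·γ_i` — and `gcd(w₀, w) = 1`.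
[cite: AbramovichQuekSchober2025, Def. 4.1 (reduced center and ℓ)] -/
def IsReducedWeights (q : ℕ) (γ : σ → ℚ) (w₀ : ℕ) (w : σ → ℕ) (ℓ : ℕ) : Prop :=
  0 < w₀ ∧ ℓ = q * w₀ ∧ (∀ i, (w i : ℚ) = ℓ * γ i) ∧
    ∀ d : ℕ, d ∣ w₀ → (∀ i, d ∣ w i) → d = 1

/-- Exponent law of the **cobordant transform** `u_i = s^{w_i} u'_i`, division by `s^ℓ`:
`u^d ↦ s^{Σ w_i d_i − ℓ}·u'^d`; the exceptional variable `s` is `none`. Natural subtraction: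
meaningful under admissibility (`Σ w_i d_i ≥ ℓ`).
[cite: AbramovichQuekSchober2025, Def. 4.5 (proper transform on B)] -/
def cobordantExponent (w : σ → ℕ) (ℓ : ℕ) (d : σ →₀ ℕ) : Option σ →₀ ℕ :=
  d.mapDomain some + Finsupp.single none ((d.sum fun i n => w i * n) - ℓ)

/-- The **cobordant (proper) transform** `F'(s, u') = s^{−ℓ} F(s^{w} u')` of the residual polynomial,
so that the proper transform of `x^q + F` on `B = Spec O[s, x', u']/(x − s^{w₀}x', u_i − s^{w_i}u'_i)`
is `x'^q + F'` (`q·w₀ = ℓ`). Włodarczyk's full cobordant blow-up is the same `B` with `t = s^{-1}`.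
[cite: AbramovichQuekSchober2025, Def. 4.5 (proper transform on B)] -/
def cobordantTransform (w : σ → ℕ) (ℓ : ℕ) (F : MvPolynomial σ K) : MvPolynomial (Option σ) K :=
  ∑ d ∈ F.support, monomial (cobordantExponent w ℓ d) (coeff d F)

/-! ## 3. Points of the exceptional divisor on `B_+` and the events -/

/-- The polynomial `F'` seen at the point `u' = b` of the exceptional divisor `{s = 0}` (`b none = 0`
for points ON the divisor): translation `u'_i ↦ u'_i + b_i`. [folklore] -/
def pointPolynomial (w : σ → ℕ) (ℓ : ℕ) (b : Option σ → K) (F : MvPolynomial σ K) :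
    MvPolynomial (Option σ) K :=
  PointBlowup.translate b (cobordantTransform w ℓ F)

/-- The point `(s = 0, x' = x₀, u' = b)` **lies on the proper transform** `x'^q + F' = 0`:
`F'(0, b) + x₀^q = 0` (over a perfect field there is exactly one `x₀` over each `b`).
[cite: AbramovichQuekSchober2025, Def. 4.5 (proper transform on B)] -/
def LiesOnProperTransform (q : ℕ) (w : σ → ℕ) (ℓ : ℕ) (x₀ : K) (b : Option σ → K)
    (F : MvPolynomial σ K) : Prop :=
  constantCoeff (pointPolynomial w ℓ b F) + x₀ ^ q = 0

/-- The point is NOT the vertex: some coordinate among `x'` and the centre variables `u'_i`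
(`w_i ≠ 0`) is non-zero (`B_+ = B ∖ V(x', u'_S)`).
[cite: Wlodarczyk2022, Def. 2.3.5 (B_+ = complement of the vertex)] -/
def OffVertex (w : σ → ℕ) (x₀ : K) (b : Option σ → K) : Prop :=
  x₀ ≠ 0 ∨ ∃ i, w i ≠ 0 ∧ b (some i) ≠ 0

/-- The **residual polynomial at the point**: `F'(s, u' + b) − F'(0, b)`; after `x' ↦ x' − x₀` the
equation at the point is `x'^q + residual` (characteristic `p`, `q = p^e`: `(x' + x₀)^q = x'^q + x₀^q`).
[folklore] -/
def residual (w : σ → ℕ) (ℓ : ℕ) (b : Option σ → K) (F : MvPolynomial σ K) :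
    MvPolynomial (Option σ) K :=
  pointPolynomial w ℓ b F - C (constantCoeff (pointPolynomial w ℓ b F))

/-- **Equimultiple point** of the weighted blow-up: the order of `x'^q + residual` at the point is again
`q`, i.e. `ord₀ residual ≥ q`. [cite: AbramovichQuekSchober2024, Thm. 1.1 (3) (the order at points over q)] -/
def IsEquimultiplePoint (q : ℕ) (w : σ → ℕ) (ℓ : ℕ) (b : Option σ → K) (F : MvPolynomial σ K) :
    Prop :=
  (q : ℕ∞) ≤ ordZero (residual w ℓ b F)

/-- **The order drops** at the point: `ord₀ residual < q` (what AQS prove at EVERY point over `q` for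
plane curves, Thm. 1.1 (3); the observatory records where it fails in higher dimension).
[cite: AbramovichQuekSchober2024, Thm. 1.1 (3) (the order drops at every point over q)] -/
def OrderDrops (q : ℕ) (w : σ → ℕ) (ℓ : ℕ) (b : Option σ → K) (F : MvPolynomial σ K) : Prop :=
  ordZero (residual w ℓ b F) < (q : ℕ∞)

/-- The **new residual polynomial** (the next state): the residual at the point cleaned of its `q`-th
power monomials (`x' ↦ x' + h(s, u')` over a perfect field, cf. `graphOrder_eq_ordZero_deletePthPowers`).
[cite: Hauser2010, §G (cleaning of p-th powers)] -/
def newResidual (q : ℕ) (w : σ → ℕ) (ℓ : ℕ) (b : Option σ → K) (F : MvPolynomial σ K) :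
    MvPolynomial (Option σ) K :=
  deletePthPowers q (residual w ℓ b F)

/-- The second entry `(q, ord₀ F_clean) ↦ (q, ord₀ F'_clean)` **drops** at the equimultiple point.
(derived here: observatory event w_a2_drop) [folklore] -/
def SecondEntryDrops (q : ℕ) (w : σ → ℕ) (ℓ : ℕ) (b : Option σ → K) (F : MvPolynomial σ K) :
    Prop :=
  ordZero (newResidual q w ℓ b F) < ordZero (deletePthPowers q F)

/-- The second entry **stalls**. (derived here: observatory event w_a2_stall) [folklore] -/
def SecondEntryStalls (q : ℕ) (w : σ → ℕ) (ℓ : ℕ) (b : Option σ → K) (F : MvPolynomial σ K) :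
    Prop :=
  ordZero (newResidual q w ℓ b F) = ordZero (deletePthPowers q F)

/-- The second entry **increases** (a weighted kangaroo for the pair). (derived here: observatory event w_a2_incr) [folklore] -/
def SecondEntryIncreases (q : ℕ) (w : σ → ℕ) (ℓ : ℕ) (b : Option σ → K) (F : MvPolynomial σ K) :
    Prop :=
  ordZero (deletePthPowers q F) < ordZero (newResidual q w ℓ b F)

/-- The transplanted invariant **drops** (ATW order) at the point. (derived here: observatory event w_inv_drop) [folklore] -/
def InvCoordDrops [Fintype σ] (q : ℕ) (w : σ → ℕ) (ℓ : ℕ) (b : Option σ → K)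
    (F : MvPolynomial σ K) : Prop :=
  ∃ v v' : ATW.Invariant, IsInvCoord q (deletePthPowers q F) v ∧
    IsInvCoord q (newResidual q w ℓ b F) v' ∧ ATW.TruncLex.lt v' v

/-- The transplanted invariant **stalls** at the point (e.g. Włodarczyk's Whitney umbrella `x² + y²z`
over `𝔽₂`, `KangarooAtlasCertWeighted.whitney_loop`). (derived here: observatory event w_inv_stall) [folklore] -/
def InvCoordStalls [Fintype σ] (q : ℕ) (w : σ → ℕ) (ℓ : ℕ) (b : Option σ → K)
    (F : MvPolynomial σ K) : Prop :=
  ∃ v : ATW.Invariant, IsInvCoord q (deletePthPowers q F) v ∧ IsInvCoord q (newResidual q w ℓ b F) v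

/-- The transplanted invariant **increases** at the point. (derived here: observatory event w_inv_incr) [folklore] -/
def InvCoordIncreases [Fintype σ] (q : ℕ) (w : σ → ℕ) (ℓ : ℕ) (b : Option σ → K)
    (F : MvPolynomial σ K) : Prop :=
  ∃ v v' : ATW.Invariant, IsInvCoord q (deletePthPowers q F) v ∧
    IsInvCoord q (newResidual q w ℓ b F) v' ∧ ATW.TruncLex.lt v v'

/-- **An étale slice exists at the point**: some non-vanishing coordinate has weight prime to `p`
(the stabiliser of the point is `μ_g`, `g = gcd` of the weights of its non-zero coordinates; the chart
`u'_i = 1` is an étale `μ_{w_i}`-quotient presentation iff `p ∤ w_i` — "Étale slices are good, flat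
slices are not"). [cite: AbramovichQuekSchober2024, Rem. 5.7 (étale versus flat slices)] -/
def HasEtaleSlice (p : ℕ) (w₀ : ℕ) (w : σ → ℕ) (x₀ : K) (b : Option σ → K) : Prop :=
  (x₀ ≠ 0 ∧ ¬ p ∣ w₀) ∨ ∃ i, b (some i) ≠ 0 ∧ w i ≠ 0 ∧ ¬ p ∣ w i

end WeightedBlowup

/-! ## 4. ATW's order is not well-founded on sequences of unbounded length -/

namespace ATW

/-- A proper extension is smaller than its truncation: `l ++ (x :: t) < l`.
[cite: AbramovichTemkinWlodarczyk2024, §5.1 (truncated sequences are larger)] -/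
theorem TruncLex.lt_append_cons {α : Type*} [LT α] (l : List α) (x : α) (t : List α) :
    TruncLex.lt (l ++ x :: t) l := by
  induction l with
  | nil => simp only [List.nil_append, TruncLex.lt]
  | cons y ys ih =>
    simp only [List.cons_append, TruncLex.lt]
    exact Or.inr ⟨trivial, ih⟩

/-- On sequences of unbounded length ATW's order has infinite descending chains, e.g.
`(2,5,5) > (2,5,5,5) > (2,5,5,5,5) > …` (the value set `Γ_n` of ATW §5.1 is well-ordered for FIXED
ambient dimension `n`; on the cobordant models of the observatory the number of variables grows by one
per weighted blow-up). (derived here) [folklore] -/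
theorem TruncLex.exists_descending_chain :
    ∃ f : ℕ → Invariant, ∀ n, TruncLex.lt (f (n + 1)) (f n) := by
  refine ⟨fun n => [2, 5, 5] ++ List.replicate n 5, fun n => ?_⟩
  have h := TruncLex.lt_append_cons ([2, 5, 5] ++ List.replicate n (5 : ℚ)) 5 []
  simpa only [List.append_assoc, List.replicate_succ'] using h

end ATW

end Literature.AlgebraicGeometry.Resolution

end
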